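import Summits.ABC.StewartYu.RecordNumericC
import HarnessLib

/-!
# Cell abc-stewartyu, Gen-3 frame at `p = 2` (crux `Y07Two`, stmt-ABC-19659), closer glue: the parameter record
# `PadicG3Par (d+1)` OF A PIVOT-LAST DATUM at `p = 2` (`K₀ = 1`, `θ₀ = 2`, `N_q = 2^{m+2}`), the ruled
# instantiation facts, and the record predicate `RecordTwo` for the datum's OWN `Vmax` (monotonicity in `Vmax`)

`Summits/ABC/StewartYu/PadicG3TwoParTwo.lean` — cell `abc-stewartyu` (HOME `run/shared/lean/pub/abc-stewartyu/`),
route `PadicPrimesKummerThird`, seat p3 (g6, F-two lead).  Two definitions (`mTwo n`, the slab depth at `p = 2`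
computed before the record exists; `parTwo`, the record of a datum) and theorems; no named fact, no numbers
beyond lp-1's `RecordNumericC`.

THE INSTANTIATION (plan g8 ruling 2026-08-27T01:00:18Z, lp-1's convention, p5's SCHEDULE-p2-v0 §1): for a datum
`(V, Vmax, W)` on `Fin (d+1)` with `1 ≤ Vⱼ ≤ Vmax`, `1 ≤ W`: `p := 2`, `A := V`, `W := W`, `K₀ := 1`, `θ₀ := 2`
(the slab gain at `p = 2` is `(m+2)·log 2` per zero), `N_q := 2^{m+2}` with `m = mTwo (d+1) = ⌈8(d+2)/log 2 − 2⌉₊`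
— two extra powers of `2` beyond lp-1's `N_q := K = 2^m`, so that `L ≥ 2^{n+25}·N_q = 8·2^{n+24+m}` absorbs the
triadic depth fit `8·3^{I*} ≤ 4L` (`3^{I*} < 3·2^{n+24+m}`) of p5's `frameNumericsTwoC_schedTwo` with NO change to
any closed form (`K ≤ N_q ≤ 2ⁿK` still holds for `n = d + 1 ≥ 2`) — and **`Amax := min Vmax (2ⁿ·∏ⱼ Vⱼ)`**, which
is `≥ every Vⱼ` (all `Vⱼ ≥ 1`) and gives lp-1's hypothesis `Amax ≤ 2ⁿ·Ω` for free.  The record predicate is then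
lifted from `Amax` to the datum's `Vmax ≥ Amax` by **`recordTwo_mono_Vmax`**: clauses (A)/(B) do not see `Vmax`;
in clause (C), `C r·P·(W + log 3 + log n + log Vmax + log P + log 2P) ≤ C n·∏V·(W + log 2Vmax)` at `Vmax₁` forces
`C r·P ≤ C n·∏V` (its bracket is `≥ W + log 2Vmax₁ > 0`, `P ≥ 1` by `RecordExits.one_le_P`), whence the
inequality at every `Vmax₂ ≥ Vmax₁`.  Result: **`recordTwo_parTwo`** — `RecordTwo C (d+1) V Vmax W P.D₀ P.S₀N
P.Xfin P.D` for the datum's record `P = parTwo …` and EVERY admissible `C` (`0 ≤ C r`, `256^{n−r}·C r ≤ C n`).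

WHAT THIS IS NOT: the frame numerics, the smallness, the END ranges (other files of the closer); no crux moves.

References: Yu. V. Nesterenko, LNM 1819 (2003), §5.2 (5.13)–(5.22); K. Yu, Acta Math. 211 (2013), §3.1.
-/

noncomputable section

open Finset
open Literature.NumberTheory.Transcendental

namespace Summit.ABC.StewartYu

/-! ### `RecordTwo` is monotone in `Vmax` -/

namespace GenThreeFrameSpecTwo

/-- **`RecordTwo` is monotone UPWARD in `Vmax`** (for `Vmax ≥ 1`, `W ≥ 0`, weights `≥ 1`, `0 ≤ C r`).
[cite: Nesterenko2003, §5.2 (5.22); shape only] -/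
theorem recordTwo_mono_Vmax {C : ℕ → ℝ} (hC : ∀ r, 0 ≤ C r) {n : ℕ} (hn : 1 ≤ n) {V : Fin n → ℝ}
    (hV1 : ∀ j, 1 ≤ V j) {Vmax Vmax' W : ℝ} (hW : 0 ≤ W) (hVmax1 : 1 ≤ Vmax) (hle : Vmax ≤ Vmax')
    {D₀ S₀ X : ℕ} {D : Fin n → ℕ} (h : RecordTwo C n V Vmax W D₀ S₀ X D) :
    RecordTwo C n V Vmax' W D₀ S₀ X D := by
  obtain ⟨hA, hB, hCl⟩ := h
  refine ⟨hA, hB, ?_⟩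
  intro r d₀ M hr0 hrn hd₀ hM hineq κ hκ hdet
  have h1 := hCl r d₀ M hr0 hrn hd₀ hM hineq κ hκ hdet
  have hP1 := RecordExits.one_le_P hn M hV1 κ hdet
  set P : ℝ := ((r.factorial : ℝ)) ^ 2 * (n : ℝ) ^ r *
      (|(Matrix.of fun i j => (M j (κ i) : ℝ)).det| * ∏ i, V (κ i)) with hPdef
  -- the two sides' coefficients
  set a : ℝ := C r * P with ha
  set b : ℝ := C n * ∏ j, V j with hb
  have ha0 : 0 ≤ a := mul_nonneg (hC r) (by linarith)
  have hb0 : 0 ≤ b := mul_nonneg (hC n) (Finset.prod_nonneg fun j _ => by linarith [hV1 j])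
  have hn1 : (1 : ℝ) ≤ n := by exact_mod_cast hn
  have hlog3 : Real.log 2 ≤ Real.log 3 := Real.log_le_log (by norm_num) (by norm_num)
  have hlog2 : 0 < Real.log 2 := Real.log_pos (by norm_num)
  have hlogn : 0 ≤ Real.log n := Real.log_nonneg hn1
  have hlogP : 0 ≤ Real.log P := Real.log_nonneg hP1
  have hlog2P : 0 ≤ Real.log (2 * P) := Real.log_nonneg (by linarith)
  have hlogV : 0 ≤ Real.log Vmax := Real.log_nonneg hVmax1
  have hVpos : 0 < Vmax := by linarith
  have hV'pos : 0 < Vmax' := by linarith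
  have hδ : Real.log Vmax ≤ Real.log Vmax' := Real.log_le_log hVpos hle
  have e1 : Real.log (2 * Vmax) = Real.log 2 + Real.log Vmax := Real.log_mul (by norm_num) hVpos.ne'
  have e2 : Real.log (2 * Vmax') = Real.log 2 + Real.log Vmax' := Real.log_mul (by norm_num) hV'pos.ne'
  -- `h1` in the letters `a`, `b`
  have h1' : a * (W + Real.log 3 + Real.log n + Real.log Vmax + Real.log P + Real.log (2 * P)) ≤
      b * (W + Real.log 2 + Real.log Vmax) := by
    have h1'' := h1
    rw [e1, ← add_assoc] at h1''
    simpa only [ha, hb, mul_assoc] using h1''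
  -- `a ≤ b`
  have hab : a ≤ b := by
    by_contra hlt
    push Not at hlt
    have hpos : 0 < W + Real.log 2 + Real.log Vmax := by linarith
    have : b * (W + Real.log 2 + Real.log Vmax) < a * (W + Real.log 2 + Real.log Vmax) :=
      mul_lt_mul_of_pos_right hlt hpos
    have : a * (W + Real.log 2 + Real.log Vmax) ≤
        a * (W + Real.log 3 + Real.log n + Real.log Vmax + Real.log P + Real.log (2 * P)) :=
      mul_le_mul_of_nonneg_left (by linarith) ha0
    linarith
  -- conclusion
  rw [e2]
  calc C r * P * (W + Real.log 3 + Real.log n + Real.log Vmax' + Real.log P + Real.log (2 * P))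
      = a * (W + Real.log 3 + Real.log n + Real.log Vmax + Real.log P + Real.log (2 * P)) +
          a * (Real.log Vmax' - Real.log Vmax) := by rw [ha]; ring
    _ ≤ b * (W + Real.log 2 + Real.log Vmax) + b * (Real.log Vmax' - Real.log Vmax) := by
        have : a * (Real.log Vmax' - Real.log Vmax) ≤ b * (Real.log Vmax' - Real.log Vmax) :=
          mul_le_mul_of_nonneg_right hab (by linarith)
        linarith
    _ = C n * (∏ j, V j) * (W + (Real.log 2 + Real.log Vmax')) := by rw [hb]; ring

end GenThreeFrameSpecTwo

/-! ### The record of a datum at `p = 2` -/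

namespace ParTwo

open PadicG3Par

/-- **The slab depth at `p = 2`**: `mTwo n = ⌈c_G (n+1)/log 2 − 2⌉₊` (`c_G = 8`, `θ₀(2) = 2`) — the value of
`PadicG3Par.m` for every record with `p = 2`, `θ₀ = 2`, computed BEFORE the record (it fixes `N_q := 2^{m+2}`).
[cite: Yu1999, p. 340; shape only] -/
def mTwo (n : ℕ) : ℕ := ⌈cG * (n + 1) / Real.log ((2 : ℕ) : ℝ) - 2⌉₊

variable {d : ℕ} (V : Fin (d + 1) → ℝ) (Vmax W : ℝ)

/-- Every weight is below `2ⁿ·∏ⱼ Vⱼ` (all weights are `≥ 1`). [folklore] -/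
theorem le_two_pow_mul_prod (hV1 : ∀ j, 1 ≤ V j) (j : Fin (d + 1)) : V j ≤ 2 ^ (d + 1) * ∏ i, V i := by
  have hprod : V j ≤ ∏ i, V i := by
    rw [← Finset.mul_prod_erase Finset.univ V (Finset.mem_univ j)]
    have h1 : 1 ≤ ∏ i ∈ Finset.univ.erase j, V i := Finset.one_le_prod fun i _ => hV1 i
    have h0 : 0 ≤ V j := by linarith [hV1 j]
    nlinarith
  have h2 : (1 : ℝ) ≤ 2 ^ (d + 1) := one_le_pow₀ (by norm_num)
  have h3 : 0 ≤ ∏ i, V i := Finset.prod_nonneg fun i _ => by linarith [hV1 i]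
  nlinarith

/-- **THE PARAMETER RECORD OF A PIVOT-LAST DATUM at `p = 2`**: `p := 2`, `A := V`, `Amax := min Vmax (2ⁿ∏V)`,
`W := W`, `N_q := 2^{mTwo n + 2}`, `K₀ := 1`, `θ₀ := 2` (`n = d + 1`). [cite: Nesterenko2003, §2 (2.3); shape only] -/
def parTwo (hV1 : ∀ j, 1 ≤ V j) (hVmax : ∀ j, V j ≤ Vmax) (hW : 1 ≤ W) : PadicG3Par (d + 1) where
  p := 2
  A := V
  Amax := min Vmax (2 ^ (d + 1) * ∏ i, V i)
  W := W
  Nq := 2 ^ (mTwo (d + 1) + 2)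
  K₀ := 1
  θ₀ := 2
  hn := Nat.le_add_left 1 d
  hp := le_rfl
  hA := fun j => le_trans (by have := Real.log_two_lt_d9; linarith) (hV1 j)
  hAmax := fun j => le_min (hVmax j) (le_two_pow_mul_prod V hV1 j)
  hAmax1 := le_min ((hV1 0).trans (hVmax 0)) ((hV1 0).trans (le_two_pow_mul_prod V hV1 0))
  hW := hW
  hNq := Nat.one_le_two_pow
  hK₀ := le_rfl
  hK₀p := by norm_num
  hθ₀ := by norm_num
  hθ₀2 := le_rfl

variable (hV1 : ∀ j, 1 ≤ V j) (hVmax : ∀ j, V j ≤ Vmax) (hW : 1 ≤ W)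

/-- Projection: `p = 2`. [folklore] -/
@[simp] theorem parTwo_p : (parTwo V Vmax W hV1 hVmax hW).p = 2 := rfl
/-- Projection: `A = V`. [folklore] -/
@[simp] theorem parTwo_A : (parTwo V Vmax W hV1 hVmax hW).A = V := rfl
/-- Projection: `Amax = min Vmax (2ⁿ∏V)`. [folklore] -/
@[simp] theorem parTwo_Amax :
    (parTwo V Vmax W hV1 hVmax hW).Amax = min Vmax (2 ^ (d + 1) * ∏ i, V i) := rfl
/-- Projection: `W`. [folklore] -/
@[simp] theorem parTwo_W : (parTwo V Vmax W hV1 hVmax hW).W = W := rfl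
/-- Projection: `N_q = 2^{m+2}`. [folklore] -/
@[simp] theorem parTwo_Nq : (parTwo V Vmax W hV1 hVmax hW).Nq = 2 ^ (mTwo (d + 1) + 2) := rfl
/-- Projection: `K₀ = 1`. [folklore] -/
@[simp] theorem parTwo_K₀ : (parTwo V Vmax W hV1 hVmax hW).K₀ = 1 := rfl
/-- Projection: `θ₀ = 2`. [folklore] -/
@[simp] theorem parTwo_θ₀ : (parTwo V Vmax W hV1 hVmax hW).θ₀ = 2 := rfl
/-- Projection: `Ω = ∏V`. [folklore] -/
@[simp] theorem parTwo_Ω : (parTwo V Vmax W hV1 hVmax hW).Ω = ∏ j, V j := rfl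

/-- **The slab depth of the record is `mTwo n`.** [folklore] -/
@[simp] theorem parTwo_m : (parTwo V Vmax W hV1 hVmax hW).m = mTwo (d + 1) := rfl

/-- **The class count of the record is `K = 2^m`.** [folklore] -/
@[simp] theorem parTwo_K : (parTwo V Vmax W hV1 hVmax hW).K = 2 ^ mTwo (d + 1) := by
  unfold PadicG3Par.K; simp

/-- The gain per zero is `G = (m + 2)·log 2`. [folklore] -/
theorem parTwo_G : (parTwo V Vmax W hV1 hVmax hW).G = (mTwo (d + 1) + 2) * Real.log 2 := by
  unfold PadicG3Par.G PadicG3Par.θm; simp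

/-- The depth of the dyadic END data: `Ŝ = n + 26 + m`. [folklore] -/
theorem parTwo_Sdepth : (parTwo V Vmax W hV1 hVmax hW).Sdepth = d + 1 + 24 + (mTwo (d + 1) + 2) := by
  unfold PadicG3Par.Sdepth; simp [Nat.log_pow]

/-! ### The ruled instantiation facts -/

/-- `K ≤ N_q` (`2^m ≤ 2^{m+2}`). [folklore] -/
theorem parTwo_K_le_Nq : (parTwo V Vmax W hV1 hVmax hW).K ≤ (parTwo V Vmax W hV1 hVmax hW).Nq := by
  rw [parTwo_K, parTwo_Nq]
  exact Nat.pow_le_pow_right (by norm_num) (by omega)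

/-- `N_q ≤ 2ⁿ·K` (`2^{m+2} ≤ 2^{d+1}·2^m` as `d ≥ 1`). [folklore] -/
theorem parTwo_Nq_le (hd : 1 ≤ d) :
    (parTwo V Vmax W hV1 hVmax hW).Nq ≤ 2 ^ (d + 1) * (parTwo V Vmax W hV1 hVmax hW).K := by
  rw [parTwo_K, parTwo_Nq, ← pow_add]
  exact Nat.pow_le_pow_right (by norm_num) (by omega)

/-- `½ ≤ θ₀`. [folklore] -/
theorem parTwo_half_le_θ₀ : (1 / 2 : ℝ) ≤ (parTwo V Vmax W hV1 hVmax hW).θ₀ := by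
  rw [parTwo_θ₀]; norm_num

/-- `Amax ≤ 2ⁿ·Ω`. [folklore] -/
theorem parTwo_Amax_le :
    (parTwo V Vmax W hV1 hVmax hW).Amax ≤ 2 ^ (d + 1) * (parTwo V Vmax W hV1 hVmax hW).Ω := by
  rw [parTwo_Amax, parTwo_Ω]; exact min_le_right _ _

/-- `Amax ≤ Vmax`. [folklore] -/
theorem parTwo_Amax_le_Vmax : (parTwo V Vmax W hV1 hVmax hW).Amax ≤ Vmax := by
  rw [parTwo_Amax]; exact min_le_left _ _

/-- `1 ≤ A j`. [folklore] -/
theorem parTwo_one_le_A (j : Fin (d + 1)) : 1 ≤ (parTwo V Vmax W hV1 hVmax hW).A j := hV1 j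

/-! ### The record predicate for the datum -/

/-- **`RecordTwo` FOR THE DATUM'S RECORD AND THE DATUM'S OWN `Vmax`**, for every admissible `C`
(`0 ≤ C r`, `256^{n−r}·C r ≤ C n`), at the dyadic END data `(P.D₀, P.S₀N, P.Xfin, P.D)` of `P = parTwo …`
(`d ≥ 1`). [cite: Nesterenko2003, §5.2 (5.13)–(5.22), Lemmas 5.3–5.4] -/
theorem recordTwo_parTwo (hd : 1 ≤ d) {C : ℕ → ℝ} (hC0 : ∀ r, 0 ≤ C r)
    (hCg : ∀ r, r < d + 1 → (256 : ℝ) ^ (d + 1 - r) * C r ≤ C (d + 1)) :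
    GenThreeFrameSpecTwo.RecordTwo C (d + 1) V Vmax W (parTwo V Vmax W hV1 hVmax hW).D₀
      (parTwo V Vmax W hV1 hVmax hW).S₀N (parTwo V Vmax W hV1 hVmax hW).Xfin
      (parTwo V Vmax W hV1 hVmax hW).D := by
  have h := (parTwo V Vmax W hV1 hVmax hW).recordTwo_of_convention (parTwo_K_le_Nq V Vmax W hV1 hVmax hW)
    (parTwo_Nq_le V Vmax W hV1 hVmax hW hd) (parTwo_half_le_θ₀ V Vmax W hV1 hVmax hW)
    (parTwo_Amax_le V Vmax W hV1 hVmax hW) (parTwo_one_le_A V Vmax W hV1 hVmax hW) hC0 hCg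
  rw [parTwo_A, parTwo_W] at h
  exact GenThreeFrameSpecTwo.recordTwo_mono_Vmax hC0 (Nat.le_add_left 1 d) hV1 (by linarith)
    (parTwo V Vmax W hV1 hVmax hW).hAmax1 (parTwo_Amax_le_Vmax V Vmax W hV1 hVmax hW) h

end ParTwo

end Summit.ABC.StewartYu

end
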